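import Summits.ResolutionOfSingularities.ResolutionOfSingularities.Theorems.PurelyInseparableDim4E2OfCJSLocalizeProof
import Summits.ResolutionOfSingularities.ResolutionOfSingularities.Theorems.PurelyInseparableDim4StrictTransformBlowupPoint
import Summits.ResolutionOfSingularities.ResolutionOfSingularities.Theorems.PurelyInseparableDim4E2NearPresentation
import Summits.ResolutionOfSingularities.ResolutionOfSingularities.Theorems.PurelyInseparableDim4SymbolicPower
import Summits.ResolutionOfSingularities.ResolutionOfSingularities.Theorems.PurelyInseparableDim4PointZigzagStep
import Literature.AlgebraicGeometry.Resolution.BlowupsFlatBaseChange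
import Literature.AlgebraicGeometry.Resolution.MarkedIdealsEtale
import Literature.AlgebraicGeometry.Resolution.HypersurfaceTransform
import Literature.AlgebraicGeometry.Resolution.MarkedIdealsLemmas
import Literature.AlgebraicGeometry.Resolution.PermissibleCentres
import Literature.AlgebraicGeometry.Resolution.RegularCentreComponents
import Literature.AlgebraicGeometry.Resolution.BlowupChartMembership
import Literature.AlgebraicGeometry.Resolution.BlowupRestrictOpen
import Literature.AlgebraicGeometry.Resolution.CoefficientDerivations
import Mathlib.RingTheory.Ideal.Colon
import HarnessLib

/-!
# F4-I(3,3) from CJS — `E2OfCJS.StrictTransformBlowup` HOLDS: the controlled transform of the hypersurface along a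
# point blow-up IS the blow-up of the hypersurface at the point, for an ARBITRARY ambient with a chart (cell `res-dim4-pi`)

[OURS · counted 0 · AI work weaker than expert review.]  Cell `res-dim4-pi` (D-0157 DOOR 2), seat `res-dim4-p-11` g2,
lane (α) of desk WORD #63 (a): close the typed-as-is OURS Prop `E2OfCJS.StrictTransformBlowup` (res-dim4-p-7 g2, p667552)
— the (M-c) statement quantified over an ARBITRARY locally Noetherian ambient `Z` (no global regularity, no global
Cartier hypothesis), with only an open-immersion CHART `φ : 𝔸⁵_K ⟶ Z` at the centre `x = φ(0)` on which the marked ideal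
reads `(z³ + F)·𝒪`, `ordZero F = 3`.  NOTHING here proves `NoIsolatedTrap 3 3`, the Cossart–Jannsen–Saito theorem, or
resolution of singularities in dimension ≥ 4 / characteristic `p`.

## The argument (base-locality WITHOUT gluing blow-ups)

res-dim4-p-5 g2's (M-c) machine (p666342) separates the blow-up statement into a UNIVERSAL-PROPERTY part that needs no
regularity at all — `StrictTransformBlowup.isBlowup_subscheme_controlledTransform_of_isEffectiveCartier`: if
`𝓗 ≤ 𝓘_x^3` and the exceptional divisor restricts to an effective Cartier divisor on `V(τᶜ(𝓗, 3))` then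
`V(τᶜ(𝓗,3)) ⟶ V(𝓗)` is a blow-up of `V(𝓗)` along `𝓘_x|_{V(𝓗)}` — and a LOCAL input, the colon-stability
`(τᶜ(𝓗,3) : 𝓘_E) ≤ τᶜ(𝓗,3)` (`isEffectiveCartier_comap_subschemeι_of_colon_le`).  Both inputs are inequalities of
ideal sheaves, hence STALK-LOCAL (`le_of_forall_stalkIdeal_le`):

* §1 `𝓗 ≤ 𝓘_x^3`: off `x` the right side is the unit ideal; at `x` it is `ord_x 𝓗 ≥ 3`, read through the chart
  (`idealOrder_comap_of_isOpenImmersion`) from the CHARACTERISTIC-FREE order computation `idealOrder (hypSheaf p F) ξ = p`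
  (`SymbolicPower.hyp_mem_idealOfVars_pow` / `hyp_not_mem_symbPow_succ`, p665211).
* §2–§3 colon-stability: off `π⁻¹(x)` the exceptional ideal is the unit ideal (`Submodule.colon_univ`); over the chart,
  pull the whole square back along `φ` (blow-ups commute with the FLAT base change `φ`: `IsBlowup.pullback_snd_of_flat`;
  controlled transforms and colons too: `comap_controlledTransform_of_flat`, `comap_colon_of_flat`) to the blow-up of
  `𝔸⁵_K` at the origin, where `𝔸⁵` IS regular, `(z³+F)·𝒪` IS an effective Cartier divisor of order `3` at the origin,
  so Kollár 3.30.2 in the tree (`IsBlowup.strictTransformIdeal_eq_controlledTransform`) + p-5's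
  `colon_controlledTransform_le_of_strictTransformIdeal_eq` give colon-stability upstairs; it descends along the open
  immersion `Z' ×_Z 𝔸⁵ ⟶ Z'` stalk by stalk (stalk maps of open immersions are isomorphisms).
* §4 the centre: `𝓘_x.comap ι = 𝓘_y` for the (unique, closed) point `y` of `V(𝓗)` over `x` (stalkwise: the maximal
  ideal maps onto the maximal ideal under the surjective local stalk map of the closed immersion).
* §5 **`E2OfCJS.strictTransformBlowup : E2OfCJS.StrictTransformBlowup`.**

Def-free.  bears_on: LADDER-RESOLUTION:D157-DOOR2 (res-dim4-pi · F4-I(3,3) · E2 (α) lane).  Supports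
stmt-ResolutionOfSingularities-16155 (helper).

## References

* J. Kollár, *Lectures on Resolution of Singularities* (2007), 3.30.2. [Kollar2007]
* E. Bierstone, D. Grigoriev, P. Milman, J. Włodarczyk, *Effective Hironaka resolution* (2011), §4 Remark (3),
  Lemma 3.6.4 (6). [BierstoneGrigorievMilmanWlodarczyk2011]
* U. Görtz, T. Wedhorn, *Algebraic Geometry I* (2020), Def. 13.90, Prop. 13.91. [GortzWedhorn2020]
-/

set_option linter.dupNamespace false -- mandated namespace of this single-conjunct summit

noncomputable section

open CategoryTheory CategoryTheory.Limits AlgebraicGeometry TopologicalSpace IsLocalRing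
open Literature.AlgebraicGeometry.Resolution
open Literature.AlgebraicGeometry.Resolution.Hauser2010 (ordZero)
open Literature.AlgebraicGeometry.Resolution.AffinePointBlowup (A P ξ isClosed_ξ)
open Literature.AlgebraicGeometry.Hironaka2017.SpecOrders (Zs St toΓ ofΓ ofΓ_toΓ toΓ_ofΓ shf shf_ideal_top)
open Scheme.IdealSheafData (vanishingIdeal)

universe u

namespace Summit.ResolutionOfSingularities.ResolutionOfSingularities.Theorems.PIDim4

namespace E2OfCJS

namespace StrictTransform

/-! ## §1 Stalk-local inequalities of ideal sheaves -/

/-- **`𝓗 ≤ 𝓘_x^m` from the order at `x`**: for a closed point `x`, if `m ≤ ord_x 𝓗` then `𝓗 ≤ 𝓘_x^m` (at `x` this is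
`𝓗_x ≤ 𝔪_x^m`; off `x` the stalk of `𝓘_x` is the unit ideal). [cite: BierstoneGrigorievMilmanWlodarczyk2011, §3.1 p. 6] -/
theorem le_vanishingIdeal_singleton_pow_of_le_idealOrder {X : Scheme.{u}} (𝓗 : X.IdealSheafData) {x : X}
    (hx : IsClosed ({x} : Set X)) {m : ℕ} (hm : (m : ℕ∞) ≤ idealOrder 𝓗 x) :
    𝓗 ≤ vanishingIdeal (⟨{x}, hx⟩ : Closeds X) ^ m := by
  refine le_of_forall_stalkIdeal_le fun z => ?_
  rw [stalkIdeal_pow]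
  by_cases hz : z = x
  · subst hz
    rw [stalkIdeal_vanishingIdeal_singleton hx]
    exact (le_idealOrder_iff 𝓗 z m).mp hm
  · rw [stalkIdeal_vanishingIdeal_of_not_mem (Z := ⟨{x}, hx⟩) (by simpa using hz), Ideal.top_pow]
    exact le_top

/-- **An inequality of ideal sheaves descends along an open immersion, stalk by stalk**: if `I.comap f ≤ J.comap f` for
an open immersion `f` then `I_z ≤ J_z` at every point `z = f w` of its image. [cite: GortzWedhorn2020, Prop. 13.91 (2)] -/
theorem stalkIdeal_le_of_comap_le {X Y : Scheme.{u}} (f : Y ⟶ X) [IsOpenImmersion f] {I J : X.IdealSheafData}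
    (h : I.comap f ≤ J.comap f) (w : Y) : stalkIdeal I (f w) ≤ stalkIdeal J (f w) := by
  have h1 : stalkIdeal (I.comap f) w ≤ stalkIdeal (J.comap f) w := stalkIdeal_mono h w
  rw [stalkIdeal_comap_eq_map, stalkIdeal_comap_eq_map] at h1
  have hbij : Function.Bijective (f.stalkMap w).hom :=
    ConcreteCategory.bijective_of_isIso (f.stalkMap w)
  have h2 := Ideal.comap_mono (f := (f.stalkMap w).hom) h1
  rwa [Ideal.comap_map_of_bijective _ hbij, Ideal.comap_map_of_bijective _ hbij] at h2

/-- **Colon-stability along a point blow-up is local over the centre**: `(T : 𝓘_x·𝒪_{Z'}) ≤ T` holds on `Z'` as soon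
as it holds after pull-back along an open immersion `s : Y' ⟶ Z'` whose image contains `π⁻¹(x)` — off `π⁻¹(x)` the
ideal `𝓘_x·𝒪_{Z'}` is the unit ideal. [cite: GortzWedhorn2020, Prop. 13.91] -/
theorem colon_comap_vanishingIdeal_le_of_comap {Z Z' Y' : Scheme.{u}} [IsLocallyNoetherian Z'] [IsLocallyNoetherian Y']
    (π : Z' ⟶ Z) {x : Z} (hx : IsClosed ({x} : Set Z)) (T : Z'.IdealSheafData) (s : Y' ⟶ Z') [IsOpenImmersion s]
    (hrange : ∀ z' : Z', π z' = x → z' ∈ Set.range s)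
    (h : colon (T.comap s) (((vanishingIdeal (⟨{x}, hx⟩ : Closeds Z)).comap π).comap s) ≤ T.comap s) :
    colon T ((vanishingIdeal (⟨{x}, hx⟩ : Closeds Z)).comap π) ≤ T := by
  refine le_of_forall_stalkIdeal_le fun z' => ?_
  by_cases hz : π z' = x
  · obtain ⟨w, rfl⟩ := hrange z' hz
    rw [← comap_colon_of_flat s] at h
    exact stalkIdeal_le_of_comap_le s h w
  · rw [stalkIdeal_colon, stalkIdeal_comap_eq_map,
      stalkIdeal_vanishingIdeal_of_not_mem (Z := ⟨{x}, hx⟩) (by simpa using hz), Ideal.map_top,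
      Submodule.top_coe, Submodule.colon_univ]

/-! ## §2 The model: `𝔸⁵_K`, its origin, and the hypersurface `(z³ + F)·𝒪` -/

variable {K : Type} [Field K]

/-- **`𝔸⁵_K` is a regular scheme** (its local rings are localisations of the regular ring `K[z, x₁, …, x₄]`).
[cite: StacksProject, Tag 02IS] -/
theorem isRegular_P : Scheme.IsRegular (P 4 K) := by
  intro y
  exact IsRegularLocalRing.of_ringEquiv
    (IsLocalization.algEquiv y.asIdeal.primeCompl (Localization.AtPrime y.asIdeal) (St (A 4 K) y)).toRingEquiv

/-- The origin of `𝔸⁵_K` is not an open point (`𝔸⁵` is irreducible with a generic point `≠ ξ`). [folklore] -/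
theorem not_isOpen_singleton_ξ : ¬ IsOpen ({ξ 4 K} : Set (P 4 K)) := by
  intro hopen
  -- the generic point `(0)` is a second point
  let η : P 4 K := ⟨⊥, Ideal.isPrime_bot⟩
  have hne : η ≠ ξ 4 K := by
    intro h
    have h1 : (MvPolynomial.X 0 : A 4 K) ∈ (ξ 4 K).asIdeal := by
      change MvPolynomial.X 0 ∈ Literature.AlgebraicGeometry.Resolution.originIdeal K (4 + 1)
      rw [Literature.AlgebraicGeometry.Resolution.mem_originIdeal_iff, MvPolynomial.constantCoeff_X]
    rw [← h] at h1
    exact MvPolynomial.X_ne_zero (R := K) (0 : Fin (4 + 1)) ((Ideal.mem_bot).mp h1)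
  have hirr : IsPreirreducible (Set.univ : Set (P 4 K)) := PreirreducibleSpace.isPreirreducible_univ
  have h := hirr {ξ 4 K} ({ξ 4 K}ᶜ) hopen (isClosed_ξ 4 K).isOpen_compl ⟨ξ 4 K, trivial, rfl⟩
    ⟨η, trivial, hne⟩
  obtain ⟨z, -, hz1, hz2⟩ := h
  exact hz2 hz1

/-- **The order of `(z^p + F)·𝒪` at the origin is EXACTLY `p`** when `ordZero F = p` (`p ≠ 0`) — characteristic-free,
through the symbolic-power calculus of `…SymbolicPower` (`z^p + F ∈ 𝔪^p`, and `∉ 𝔪^{(p+1)}` because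
`D^{(p e_z)}(z^p + F) = 1`). [cite: Hauser2010, §C (order of X at a point)] -/
theorem idealOrder_hypSheaf_ξ {p : ℕ} (hp : p ≠ 0) (F : MvPolynomial (Fin 4) K) (hF : ordZero F = (p : ℕ∞)) :
    idealOrder (hypSheaf p F) (ξ 4 K) = (p : ℕ∞) := by
  have hid : MvPolynomial.idealOfVars (Fin (4 + 1)) K = (ξ 4 K).asIdeal := by
    rw [Literature.RingTheory.MvPolynomial.idealOfVars_eq_ker_constantCoeff]; rfl
  haveI : (MvPolynomial.idealOfVars (Fin (4 + 1)) K).IsPrime := by rw [hid]; infer_instance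
  have hstalk := E2Near.stalkIdeal_hypSheaf_origin p F
  -- lower bound
  have hle : (p : ℕ∞) ≤ idealOrder (hypSheaf p F) (ξ 4 K) := by
    rw [le_idealOrder_iff, hstalk, Ideal.span_singleton_le_iff_mem,
      ← IsLocalization.AtPrime.map_eq_maximalIdeal (ξ 4 K).asIdeal (St (A 4 K) (ξ 4 K)), ← Ideal.map_pow]
    apply Ideal.mem_map_of_mem
    rw [← hid]
    exact SymbolicPower.hyp_mem_idealOfVars_pow (by rw [hF])
  -- upper bound: not in `𝔪^{p+1}`
  have hnot : ¬ ((p + 1 : ℕ) : ℕ∞) ≤ idealOrder (hypSheaf p F) (ξ 4 K) := by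
    rw [le_idealOrder_iff, hstalk, Ideal.span_singleton_le_iff_mem]
    intro hmem
    have h2 : hyp p F ∈ HironakaScheme.symbPow K (MvPolynomial.idealOfVars (Fin (4 + 1)) K) (p + 1) := by
      rw [hid]
      exact (CoeffDerivation.exists_mul_mem_pow_iff_algebraMap_mem (ξ 4 K).asIdeal (St (A 4 K) (ξ 4 K))
        (hyp p F) (p + 1)).mpr hmem
    exact SymbolicPower.hyp_not_mem_symbPow_succ hp F (Q := MvPolynomial.idealOfVars (Fin (4 + 1)) K) h2
  refine le_antisymm ?_ hle
  by_contra hlt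
  push Not at hlt
  exact hnot (Order.add_one_le_of_lt (by exact_mod_cast hlt))

/-- A ring homomorphism with a two-sided inverse preserves nonzerodivisors. [folklore] -/
theorem mem_nonZeroDivisors_toΓ {R : Type} [CommRing R] {f : R} (hf : f ∈ nonZeroDivisors R) :
    toΓ R f ∈ nonZeroDivisors Γ(Zs R, ⊤) := by
  rw [mem_nonZeroDivisors_iff_right]
  intro y hy
  have h1 : ofΓ R y * f = 0 := by
    have := congrArg (ofΓ R) hy
    rwa [map_mul, ofΓ_toΓ, map_zero] at this
  have h2 : ofΓ R y = 0 := (mem_nonZeroDivisors_iff_right.mp hf) _ h1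
  rw [← toΓ_ofΓ R y, h2, map_zero]

/-- **`(z^p + F)·𝒪_{𝔸⁵}` is an effective Cartier divisor** (a principal ideal of the domain `K[z,x]` generated by the
non-zero `z³ + F`). [cite: GortzWedhorn2020, Def. 11.38 / (13.19)] -/
theorem isEffectiveCartier_hypSheaf_three (F : MvPolynomial (Fin 4) K) : IsEffectiveCartier (hypSheaf 3 F) := by
  rw [Equimultiple.hypSheaf_eq_shf]
  refine isEffectiveCartier_of_ideal_top_eq_span _ (g := toΓ (A 4 K) (hyp 3 F))
    (mem_nonZeroDivisors_toΓ (mem_nonZeroDivisors_of_ne_zero (hyp_three_ne_zero K F))) ?_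
  rw [shf_ideal_top, Ideal.map_span, Set.image_singleton]

/-! ## §3 Colon-stability of the controlled transform over the chart -/

/-- **Colon-stability upstairs.**  On the blow-up `π₀ : Y' ⟶ 𝔸⁵_K` of the origin, the controlled transform of
`(z³ + F)·𝒪` with weight `3 = ord₀` is `𝓘_E`-colon-stable (Kollár 3.30.2: it is the strict transform ideal).
[cite: Kollar2007, 3.30.2] -/
theorem colon_controlledTransform_hypSheaf_le {Y' : Scheme.{0}} [IsLocallyNoetherian Y'] {π₀ : Y' ⟶ P 4 K}
    (F : MvPolynomial (Fin 4) K) (hF : ordZero F = (3 : ℕ∞))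
    (hπ₀ : IsBlowup π₀ (vanishingIdeal (⟨{ξ 4 K}, isClosed_ξ 4 K⟩ : Closeds (P 4 K)))) :
    colon (controlledTransform π₀ (vanishingIdeal (⟨{ξ 4 K}, isClosed_ξ 4 K⟩ : Closeds (P 4 K))) (hypSheaf 3 F) 3)
        ((vanishingIdeal (⟨{ξ 4 K}, isClosed_ξ 4 K⟩ : Closeds (P 4 K))).comap π₀) ≤
      controlledTransform π₀ (vanishingIdeal (⟨{ξ 4 K}, isClosed_ξ 4 K⟩ : Closeds (P 4 K))) (hypSheaf 3 F) 3 := by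
  have hsupp : ((vanishingIdeal (⟨{ξ 4 K}, isClosed_ξ 4 K⟩ : Closeds (P 4 K))).support : Set (P 4 K)) = {ξ 4 K} :=
    Scheme.IdealSheafData.coe_support_vanishingIdeal _
  have hη : IsGenericPoint (ξ 4 K)
      ((vanishingIdeal (⟨{ξ 4 K}, isClosed_ξ 4 K⟩ : Closeds (P 4 K))).support : Set (P 4 K)) := by
    rw [hsupp, isGenericPoint_def, (isClosed_ξ 4 K).closure_eq]
  have hint : interior ((vanishingIdeal (⟨{ξ 4 K}, isClosed_ξ 4 K⟩ : Closeds (P 4 K))).support : Set (P 4 K)) = ∅ := by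
    rw [hsupp]
    exact StrictTransformBlowup.interior_singleton_eq_empty_of_not_isOpen not_isOpen_singleton_ξ
  have hstrict := IsBlowup.strictTransformIdeal_eq_controlledTransform isRegular_P
    (isRegular_subscheme_vanishingIdeal_singleton (isClosed_ξ 4 K)) hη hint
    (idealOrder_hypSheaf_ξ (p := 3) (by norm_num) F hF) (isEffectiveCartier_hypSheaf_three F) hπ₀
  exact StrictTransformBlowup.colon_controlledTransform_le_of_strictTransformIdeal_eq _ _ _
    (by exact_mod_cast hstrict)

/-- **Colon-stability on `Z'`.**  For the data of `StrictTransformBlowup` (chart `φ : 𝔸⁵ ⟶ Z` at `x`, `M.ideal.comap φ =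
hypSheaf 3 F`, `π` a blow-up of `Z` at `x`): `(τᶜ(M.ideal, 3) : 𝓘_x·𝒪_{Z'}) ≤ τᶜ(M.ideal, 3)` — by §3 upstairs on the base
change `Z' ×_Z 𝔸⁵ ⟶ 𝔸⁵` (blow-ups, controlled transforms and colons commute with the flat base change `φ`) and descent
along the open immersion `Z' ×_Z 𝔸⁵ ⟶ Z'`, whose image is `π⁻¹(φ(𝔸⁵)) ⊇ π⁻¹(x)`. [cite: GortzWedhorn2020, Prop. 13.91] -/
theorem colon_controlledTransform_le {Z Z' : Scheme.{0}} [IsLocallyNoetherian Z] (F : MvPolynomial (Fin 4) K)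
    (hF : ordZero F = (3 : ℕ∞)) (M : MarkedIdeal Z) {x : Z} (hx : IsClosed ({x} : Set Z)) (φ : P 4 K ⟶ Z)
    [IsOpenImmersion φ] (π : Z' ⟶ Z) (hφ : φ (ξ 4 K) = x) (hM : M.ideal.comap φ = hypSheaf 3 F)
    (hπ : IsBlowup π (vanishingIdeal (⟨{x}, hx⟩ : Closeds Z))) :
    colon (controlledTransform π (vanishingIdeal (⟨{x}, hx⟩ : Closeds Z)) M.ideal 3)
        ((vanishingIdeal (⟨{x}, hx⟩ : Closeds Z)).comap π) ≤
      controlledTransform π (vanishingIdeal (⟨{x}, hx⟩ : Closeds Z)) M.ideal 3 := by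
  haveI : IsLocallyNoetherian Z' := hπ.isLocallyNoetherian
  haveI : IsLocallyNoetherian (pullback π φ) := isLocallyNoetherian_of_isOpenImmersion (pullback.fst π φ)
  -- the base change along the chart: `π₀ = pullback.snd : Z' ×_Z 𝔸⁵ ⟶ 𝔸⁵` is the blow-up of the origin
  have hC : (vanishingIdeal (⟨{x}, hx⟩ : Closeds Z)).comap φ =
      vanishingIdeal (⟨{ξ 4 K}, isClosed_ξ 4 K⟩ : Closeds (P 4 K)) :=
    Equimultiple.comap_vanishingIdeal_singleton_of_isOpenImmersion φ (ξ 4 K) hx hφ (isClosed_ξ 4 K)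
  have hπ₀ : IsBlowup (pullback.snd π φ) (vanishingIdeal (⟨{ξ 4 K}, isClosed_ξ 4 K⟩ : Closeds (P 4 K))) := by
    rw [← hC]; exact hπ.pullback_snd_of_flat φ
  have hup := colon_controlledTransform_hypSheaf_le F hF hπ₀
  -- transport the transform and the exceptional ideal along the square
  have hsq : pullback.fst π φ ≫ π = pullback.snd π φ ≫ φ := pullback.condition
  have hT : (controlledTransform π (vanishingIdeal (⟨{x}, hx⟩ : Closeds Z)) M.ideal 3).comap (pullback.fst π φ) =
      controlledTransform (pullback.snd π φ) (vanishingIdeal (⟨{ξ 4 K}, isClosed_ξ 4 K⟩ : Closeds (P 4 K)))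
        (hypSheaf 3 F) 3 := by
    rw [comap_controlledTransform_of_flat (t := φ) hsq, hC, hM]
  have hE : (((vanishingIdeal (⟨{x}, hx⟩ : Closeds Z)).comap π).comap (pullback.fst π φ)) =
      (vanishingIdeal (⟨{ξ 4 K}, isClosed_ξ 4 K⟩ : Closeds (P 4 K))).comap (pullback.snd π φ) := by
    rw [← Scheme.IdealSheafData.comap_comp, hsq, Scheme.IdealSheafData.comap_comp, hC]
  refine colon_comap_vanishingIdeal_le_of_comap π hx _ (pullback.fst π φ) ?_ ?_
  · intro z' hz'
    rw [Scheme.Pullback.range_fst]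
    exact ⟨ξ 4 K, hφ.trans hz'.symm⟩
  · rw [hT, hE]
    exact hup

/-! ## §4 The centre on the hypersurface: `𝓘_x|_{V(𝓗)} = 𝓘_y` -/

/-- **The reduced point pulls back to the reduced point along a closed immersion**: for the closed subscheme
`ι : V(I) ⟶ Z` and the (unique) point `y` over a closed point `x`, `𝓘_x.comap ι = 𝓘_y` (stalkwise: the maximal ideal
of `𝒪_{Z,x}` maps ONTO the maximal ideal of `𝒪_{V(I),y}` under the surjective local stalk map; off `y` both sides are
the unit ideal). [cite: GortzWedhorn2020, Prop. 13.91 (2)] -/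
theorem comap_subschemeι_vanishingIdeal_singleton_eq {Z : Scheme.{u}} (I : Z.IdealSheafData) {x : Z}
    (hx : IsClosed ({x} : Set Z)) (y : ↥I.subscheme) (hy : I.subschemeι y = x)
    (hycl : IsClosed ({y} : Set ↥I.subscheme)) :
    (vanishingIdeal (⟨{x}, hx⟩ : Closeds Z)).comap I.subschemeι = vanishingIdeal (⟨{y}, hycl⟩ : Closeds ↥I.subscheme) := by
  subst hy
  refine ext_of_forall_stalkIdeal_eq fun y' => ?_
  rw [stalkIdeal_comap_eq_map]
  by_cases h : y' = y
  · subst h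
    rw [stalkIdeal_vanishingIdeal_singleton hycl, stalkIdeal_vanishingIdeal_singleton hx]
    have hsurj : Function.Surjective (I.subschemeι.stalkMap y').hom := I.subschemeι.stalkMap_surjective y'
    have hcomap : (maximalIdeal (I.subscheme.presheaf.stalk y')).comap (I.subschemeι.stalkMap y').hom =
        maximalIdeal (Z.presheaf.stalk (I.subschemeι y')) := by
      have := IsLocalRing.comap_closedPoint (I.subschemeι.stalkMap y').hom
      exact congrArg PrimeSpectrum.asIdeal this
    rw [← hcomap, Ideal.map_comap_of_surjective _ hsurj]
  · have hne : I.subschemeι y' ≠ I.subschemeι y := fun h' =>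
      h (I.subschemeι.isClosedEmbedding.injective h')
    rw [stalkIdeal_vanishingIdeal_of_not_mem (Z := ⟨{I.subschemeι y}, hx⟩) (by simpa using hne), Ideal.map_top,
      stalkIdeal_vanishingIdeal_of_not_mem (Z := ⟨{y}, hycl⟩) (by simpa using h)]

/-! ## §5 `StrictTransformBlowup` holds -/

/-- **`E2OfCJS.StrictTransformBlowup` HOLDS** (the typed-as-is (M-c) of p667552): for an arbitrary locally Noetherian `Z`
with a chart `φ : 𝔸⁵_K ⟶ Z` at the closed point `x` on which the marked ideal `M` (mult `3`) reads `(z³ + F)·𝒪`,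
`ordZero F = 3`, and a blow-up `π : Z' ⟶ Z` of `x`: the subscheme of `M' = M.transform π 𝓘_x` maps to `V(M.ideal)` over `π`,
and this map is the blow-up of `V(M.ideal)` at the closed point `y` over `x`.  Universal-property half:
`StrictTransformBlowup.isBlowup_subscheme_controlledTransform_of_isEffectiveCartier` (p-5 g2); its two inputs are §1 and
§3 (Cartier restriction through `isEffectiveCartier_comap_subschemeι_of_colon_le`); the centre is rewritten by §4.
[OURS · (M-c) adapter · counted 0] [cite: Kollar2007, 3.30.2] [cite: BierstoneGrigorievMilmanWlodarczyk2011, §4 Remark (3)] -/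
theorem strictTransformBlowup_unfolded {Z Z' : Scheme.{0}} [IsLocallyNoetherian Z] (F : MvPolynomial (Fin 4) K)
    (M : MarkedIdeal Z) (x : Z) (hx : IsClosed ({x} : Set Z)) (φ : P 4 K ⟶ Z) [IsOpenImmersion φ] (π : Z' ⟶ Z)
    (hmult : M.mult = 3) (hF : ordZero F = (3 : ℕ∞)) (hφ : φ (ξ 4 K) = x) (hM : M.ideal.comap φ = hypSheaf 3 F)
    (hπ : IsBlowup π (vanishingIdeal (⟨{x}, hx⟩ : Closeds Z))) :
    ∃ ρ : (M.transform π (vanishingIdeal (⟨{x}, hx⟩ : Closeds Z))).ideal.subscheme ⟶ M.ideal.subscheme,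
      ρ ≫ M.ideal.subschemeι = (M.transform π (vanishingIdeal (⟨{x}, hx⟩ : Closeds Z))).ideal.subschemeι ≫ π ∧
      ∀ (y : M.ideal.subscheme) (hy : IsClosed ({y} : Set M.ideal.subscheme)), M.ideal.subschemeι y = x →
        IsBlowup ρ (vanishingIdeal ⟨{y}, hy⟩) := by
  haveI : IsLocallyNoetherian Z' := hπ.isLocallyNoetherian
  -- `M'.ideal = τᶜ(M.ideal, 3)` definitionally
  have hM' : (M.transform π (vanishingIdeal (⟨{x}, hx⟩ : Closeds Z))).ideal =
      controlledTransform π (vanishingIdeal (⟨{x}, hx⟩ : Closeds Z)) M.ideal 3 := by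
    rw [MarkedIdeal.transform_ideal, hmult]
  -- input 1: `M.ideal ≤ 𝓘_x^3`
  have hord : idealOrder M.ideal x = (3 : ℕ∞) := by
    rw [← hφ, ← idealOrder_comap_of_isOpenImmersion φ M.ideal (ξ 4 K), hM]
    exact_mod_cast idealOrder_hypSheaf_ξ (p := 3) (by norm_num) F hF
  have hle : M.ideal ≤ vanishingIdeal (⟨{x}, hx⟩ : Closeds Z) ^ 3 :=
    le_vanishingIdeal_singleton_pow_of_le_idealOrder M.ideal hx (by rw [hord]; exact_mod_cast le_rfl)
  -- input 2: the exceptional divisor restricts to an effective Cartier divisor on `V(τᶜ)`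
  have hcart := StrictTransformBlowup.isEffectiveCartier_comap_subschemeι_of_colon_le hπ.isEffectiveCartier
    (colon_controlledTransform_le F hF M hx φ π hφ hM hπ)
  -- the morphism `ρ` and the universal property
  rw [hM']
  obtain ⟨ρ, hρ⟩ := StrictTransformBlowup.exists_hom_subscheme_controlledTransform_weight π
    (vanishingIdeal (⟨{x}, hx⟩ : Closeds Z)) M.ideal 3
  refine ⟨ρ, hρ, fun y hy hyx => ?_⟩
  rw [← comap_subschemeι_vanishingIdeal_singleton_eq M.ideal hx y hyx hy]
  exact StrictTransformBlowup.isBlowup_subscheme_controlledTransform_of_isEffectiveCartier hπ hle hcart ρ hρ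

end StrictTransform

/-- **`E2OfCJS.StrictTransformBlowup` (p667552) HOLDS.** [OURS · (M-c) adapter · counted 0] [cite: Kollar2007, 3.30.2] -/
theorem strictTransformBlowup : StrictTransformBlowup := by
  intro K _ F Z Z' _ _ M M' x hx φ _ π hmult hF hφ hM hπ hMM'
  subst hMM'
  exact StrictTransform.strictTransformBlowup_unfolded F M x hx φ π hmult hF hφ hM hπ

end E2OfCJS

end Summit.ResolutionOfSingularities.ResolutionOfSingularities.Theorems.PIDim4

end
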